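import Mathlib
import HarnessLib
import Literature.MathematicalPhysics.QuantumFieldTheory.YangMillsOS
import Summits.QuantumFields.YangMills.Theorems.DiagonalMirrorRPR.Negative.InfiniteCouplingSlice

/-!
# `HypercubicLimit` / line `conditional-mean-telescoping` — bookkeeping bridge for the closure:
# all-pairs decay at rate `m(β)` (clause (ii) of the line's `GapData`, = the conclusion of item
# stmt-QuantumFields-8901 for `r`) ⇒ `HasLatticeMassGap r sch Δ` along every admissible scheme

Support file for crux `stmt-QuantumFields-8646`.  Tree vocabulary only (`SpeciesScheme`,
`YMSpecies`, `latticeConnectedCorr`, `HasLatticeMassGap`); nothing posited, no new `def`.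

* `hasLatticeMassGap_of_allPairsDecay`: per-pair `(C, S₀)` decay bounds uniform in `β ≥ β₁` with
  `n ≤ S` give `HasLatticeMassGap r sch Δ` for every scheme with `β₁ ≤ β_k` and `Δ · a_k ≤ m(β_k)`
  eventually (the per-pair `S₀(A, B)` is absorbed by `L_k → ∞` — tree
  `DiagonalMirrorRPR.Negative.eventually_le_schemeL`; `C ≥ 0` by the instance `n = 0`).
* `hasLatticeMassGap_one_of_allPairsDecay`: the closure's instance `a_k = m(β_k)`, `Δ = 1`.
-/

noncomputable section

open MeasureTheory Filter Topology
open Literature.MathematicalPhysics.AQFT Literature.MathematicalPhysics.QuantumLattice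
open Literature.MathematicalPhysics.QuantumFieldTheory
open Summit.QuantumFields.YangMills.Theorems.DiagonalMirrorRPR.Negative (eventually_le_schemeL)

namespace Summit.QuantumFields.YangMills.Cruxes.HypercubicLimit.ConditionalMeanTelescoping

section Bridge

variable {G : Type} [Group G] [TopologicalSpace G] [IsTopologicalGroup G] [CompactSpace G]
  [MeasurableSpace G] [BorelSpace G]

/-- **Bridge (bookkeeping).** If the connected torus time-correlations of every pair of
gauge-invariant local observables decay at rate `m(β)` with per-pair constants `(C, S₀)` uniform in
`β ≥ β₁` (clause (ii) of the line's `GapData`, = the conclusion of item 8901 for `r`), then EVERY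
scheme whose couplings satisfy `β₁ ≤ β_k` and `Δ · a_k ≤ m(β_k)` for all large `k` has the uniform
lattice mass gap `HasLatticeMassGap r sch Δ`: the per-pair threshold `S₀(A, B)` is eventually below
`L_k → ∞`, and `C e^{-m(β_k) n} ≤ C e^{-Δ a_k n}`. -/
theorem hasLatticeMassGap_of_allPairsDecay (r : LatticeRep G) (β₁ : ℝ) (m : ℝ → ℝ)
    (hii : ∀ A B : YMSpecies G, ∃ (C : ℝ) (S₀ : ℕ), ∀ β : ℝ, β₁ ≤ β → ∀ S : ℕ, S₀ ≤ S →
      ∀ n : ℕ, n ≤ S →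
        |latticeConnectedCorr r.ρ β (2 * S + 1) A.F B.F n| ≤ C * Real.exp (-(m β * n)))
    (sch : SpeciesScheme (YMSpecies G)) (Δ : ℝ)
    (hβ : ∀ᶠ k in atTop, β₁ ≤ sch.β k) (ha : ∀ᶠ k in atTop, Δ * sch.a k ≤ m (sch.β k)) :
    HasLatticeMassGap r sch Δ := by
  intro A B
  obtain ⟨C, S₀, hC⟩ := hii A B
  refine ⟨C, ?_⟩
  filter_upwards [hβ, ha, eventually_le_schemeL sch S₀] with k hβk hak hLk
  intro S hS n hn
  have hS₀ : S₀ ≤ S := hLk.trans hS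
  have h1 := hC (sch.β k) hβk S hS₀ n hn
  have hC0 : 0 ≤ C := by
    have h0 := hC (sch.β k) hβk S hS₀ 0 (Nat.zero_le _)
    simp only [Nat.cast_zero, mul_zero, neg_zero, Real.exp_zero, mul_one] at h0
    exact (abs_nonneg _).trans h0
  refine h1.trans (mul_le_mul_of_nonneg_left (Real.exp_le_exp.2 ?_) hC0)
  have hn0 : (0 : ℝ) ≤ n := Nat.cast_nonneg _
  have := mul_le_mul_of_nonneg_right hak hn0
  rw [mul_assoc] at this
  linarith

/-- **The closure's instance** (`a_k := m(β_k)`, `Δ = 1`): clause (ii) of `GapData` gives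
`HasLatticeMassGap r sch 1` verbatim for every scheme with `β_k ≥ β₁` and `a_k = m(β_k)` eventually. -/
theorem hasLatticeMassGap_one_of_allPairsDecay (r : LatticeRep G) (β₁ : ℝ) (m : ℝ → ℝ)
    (hii : ∀ A B : YMSpecies G, ∃ (C : ℝ) (S₀ : ℕ), ∀ β : ℝ, β₁ ≤ β → ∀ S : ℕ, S₀ ≤ S →
      ∀ n : ℕ, n ≤ S →
        |latticeConnectedCorr r.ρ β (2 * S + 1) A.F B.F n| ≤ C * Real.exp (-(m β * n)))
    (sch : SpeciesScheme (YMSpecies G))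
    (hβ : ∀ᶠ k in atTop, β₁ ≤ sch.β k) (ha : ∀ᶠ k in atTop, sch.a k = m (sch.β k)) :
    HasLatticeMassGap r sch 1 :=
  hasLatticeMassGap_of_allPairsDecay r β₁ m hii sch 1 hβ (ha.mono fun k hk => by rw [one_mul, hk])

end Bridge

/-- **Registered sub-goal form** (closed over the group data, one line, no binders before the colon):
clause (ii) of the line's `GapData` — all-pairs decay of connected torus time-correlations at rate
`m(β)`, per-pair constants uniform in `β ≥ β₁` — gives `HasLatticeMassGap r sch Δ` for every scheme with
`β₁ ≤ β_k` and `Δ a_k ≤ m(β_k)` eventually.  This is the bookkeeping step of the closure stub that turns the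
imported infrared input into the crux's lattice-gap clause verbatim. -/
theorem allPairsDecay_hasLatticeMassGap :
    ∀ (G : Type) [Group G] [TopologicalSpace G] [IsTopologicalGroup G] [CompactSpace G] [MeasurableSpace G] [BorelSpace G] (r : LatticeRep G) (β₁ : ℝ) (m : ℝ → ℝ), (∀ A B : YMSpecies G, ∃ (C : ℝ) (S₀ : ℕ), ∀ β : ℝ, β₁ ≤ β → ∀ S : ℕ, S₀ ≤ S → ∀ n : ℕ, n ≤ S → |latticeConnectedCorr r.ρ β (2 * S + 1) A.F B.F n| ≤ C * Real.exp (-(m β * n))) → ∀ (sch : SpeciesScheme (YMSpecies G)) (Δ : ℝ), (∀ᶠ k in atTop, β₁ ≤ sch.β k) → (∀ᶠ k in atTop, Δ * sch.a k ≤ m (sch.β k)) → HasLatticeMassGap r sch Δ :=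
  fun _G _ _ _ _ _ _ r β₁ m hii sch Δ hβ ha => hasLatticeMassGap_of_allPairsDecay r β₁ m hii sch Δ hβ ha


end Summit.QuantumFields.YangMills.Cruxes.HypercubicLimit.ConditionalMeanTelescoping

end
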